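import Summits.CriticalPhenomena.PercolationContinuityZ3.Theorems.Transplant.SkelFrmBChoiceRadiiT
import Summits.CriticalPhenomena.PercolationContinuityZ3.Theorems.Transplant.SkelFrmBParamsSlotsTA
import Summits.CriticalPhenomena.PercolationContinuityZ3.Theorems.Transplant.SkelFrmBParamsKitS
import Summits.CriticalPhenomena.PercolationContinuityZ3.Theorems.Transplant.SkelFrmBChoiceRows
import HarnessLib

/-!
(R-40) `…T` TWIN (stmt-g21, 2026-08-23; ruling p3-g16 06:23:56Z, J18; lead g11 06:35:07Z: the choice function of record moves to `frmChoiceAllQ3T`): the twin of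
`SkelFrmBChoiceRows` over the PER-AXIS-capped staggered cells `NegB.fcellsT : PCells2T` / the column slot `offNT` / the schedule `schedOfT` / the scheme `ΓQT` / the choices
`choiceAtQ3T` (SkelFrmBChoiceDefsT); statements and proofs VERBATIM with the S ↦ T tokens of record (stmt's table + hp-8 g42's registry renamedT.txt); the CELL-FREE
declarations of `SkelFrmBChoiceRows` are NOT re-declared (they serve the T function as landed — `SkelFrmBChoiceRows` is imported); NO landed file is edited.

# N2 (frames-only node `SamePDropOfSkeletonFrm₁`, OPEN), WAVE 1 VALUE ROWS: the short-region radius against the cells and the cube at the BOX SLOT OF RECORD `gT` —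
# `RA'_le_r_TA`, **`hRs5_TAT`** (`Rs + 1 ≤ 5·r_i`), and the `ex`-floor forms `hRsQ_of_le_exT` / `hRsR_of_le_exT` (p3-g16's row table 2026-08-23T03:36:36Z)

Twin of N1's `SkelNegBParamsRootAA.RA'_le_r_TA` over `PlanarSkeletonFrm`/`DataNS` (the (ζ′) cells `fcellsA` at `g := KS.gT mk gx`: `K·Kq·(6RA′+11) ≤ r₀`, `K·Kq·(14RA′+27) ≤ r₁`,
SlotsTA `r_geTA` ✓), whence `KS.RA′ ≤ r_i` and — since `KS.Rs + 2 < KS.RA′` (KitS `T₀a_lt_RA'`) — the root-cell row **`hRs5 : ∀ i, KS.Rs + 1 ≤ 5·(fcellsT …).r i`** for every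
creep value (`fcellsT.toPCells2 = fcellsA`).  The cube/window rows `hRsQ : Rs + 2 ≤ rQ 0 0`, `hRsR : Rs ≤ R (:= rQ α x)`, `hRLQ : RL + 2 ≤ rQ 0 0` are floors on the residual
`ex` of the block `SUS ex mx` through `le_rQ_of_le_exT` (ChoiceRadii); stated here by name for the two `Rs` rows.
builds on p205010 (kernel theorem, internal audit signed; external expert review pending) — nothing in this file uses p205010; NOTHING is claimed about the open node
`SamePDropOfSkeletonFrm₁` (`SamePDropOfSkeletonNeg₁` is CLOSED in the tree and untouched by this file).
Lane `prim-bschramm`, seat `prim-bschramm-stmt` (gen 20); helper file (`--supports stmt-CriticalPhenomena-4575 --as helper`).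
[cite: KozmaNitzan2024, §4 Theorem 6 (pp. 25–31): the order of constants; p. 28 ((32))] [cite: MartineauTassion2017, §4.3]
-/

noncomputable section

open scoped Classical

namespace Summit.CriticalPhenomena.PercolationContinuityZ3.Theorems.Transplant

namespace PlanarSkeletonFrm

namespace NegB

open Literature.Probability.Percolation Literature.Probability.LatticeModels SimpleGraph
open SkelConc (Consts)
open Neg

section AtT

variable (κ : Consts) {V : Type} [DecidableEq V] [Countable V] {G : SimpleGraph V} [G.LocallyFinite] (Φ : PlanarSkeletonFrm G) (t : V)
  (p : unitInterval) (D : Skelφ.StepI.DataNS V) (mk : ℕ) (gx : Neg.FSlot) (f : ℕ) (c : Fin 2 → ℕ)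

-- (cell-free, not re-declared: `RA'_le_r_TA` of SkelFrmBChoiceRows)

/-- **`hRs5`: `Rs + 1 ≤ 5·r_i`** (indeed `Rs + 3 ≤ r_i`) at `g := gT`, for the staggered cells `fcellsT … c` (any creep value). [folklore] -/
theorem hRs5_TAT (hN : EqNumL κ Φ t p D (KS.gT mk gx κ Φ t p D) f) (hκ : (hL κ Φ t p D (KS.gT mk gx κ Φ t p D) f).natAbs ≤ 10 * nL κ Φ t p D (KS.gT mk gx κ Φ t p D) f) :
    ∀ i, KS.Rs t D mk + 1 ≤ 5 * (fcellsT κ Φ t p D (KS.gT mk gx κ Φ t p D) f c).r i := by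
  intro i
  have h1 := RA'_le_r_TA κ Φ t p D mk gx f hN hκ i
  have h2 := (KS.T₀a_lt_RA' κ Φ t p D mk).2.1
  rw [fcellsT_r]
  have h3 : (KS.Rs t D mk : ℤ) + 2 < ((fcellsA κ Φ t p D (KS.gT mk gx κ Φ t p D) f).r i : ℤ) := lt_of_lt_of_le (by exact_mod_cast h2) h1
  omega

end AtT

section AtSUS

variable (κ : Consts) {V : Type} [DecidableEq V] [Countable V] {G : SimpleGraph V} [G.LocallyFinite] (Φ : PlanarSkeletonFrm G) (t : V)
  (p : unitInterval) (D : Skelφ.StepI.DataNS V) (g f : ℕ) (c : Fin 2 → ℕ) (mk : ℕ) (ex mx : GSlot) (q : unitInterval)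

/-- **`hRsQ` as a floor on `ex`**: `Rs + 2 ≤ ex → Rs + 2 ≤ rQ 0 0` at the schedule of record. [folklore] -/
theorem hRsQ_of_le_exT (h : KS.Rs t D mk + 2 ≤ ex κ Φ t p D g f) :
    KS.Rs t D mk + 2 ≤ (schedOfT κ Φ t p D g f c (SUS ex mx κ Φ t p D g f q)).rQ 0 0 :=
  le_rQ_of_le_exT κ Φ t p D g f c ex mx q h 0 0

/-- **`hRsR` as a floor on `ex`**: `Rs ≤ ex → Rs ≤ rQ a x` (the corridor window radius `R := rQ α x`). [folklore] -/
theorem hRsR_of_le_exT (h : KS.Rs t D mk ≤ ex κ Φ t p D g f) (a : ℕ) (x : Site 2) :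
    KS.Rs t D mk ≤ (schedOfT κ Φ t p D g f c (SUS ex mx κ Φ t p D g f q)).rQ a x :=
  le_rQ_of_le_exT κ Φ t p D g f c ex mx q h a x

end AtSUS

end NegB

end PlanarSkeletonFrm

end Summit.CriticalPhenomena.PercolationContinuityZ3.Theorems.Transplant

end
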